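import Literature.NumberTheory.EllipticCurves.CongruentNumberEvenMonskySelmerLocal
import HarnessLib

/-!
# Monsky's `2`-Selmer formula for `E_{2p₁⋯p_k} : y² = x³ − (2p₁⋯p_k)²x`, UPPER-BOUND HALF, for every `k`

Topic `NumberTheory/EllipticCurves`; namespace
`Literature.NumberTheory.EllipticCurves.CongruentNumberEvenMonskySelmer`. A pure proof file (theorems only);
part 2 of 2 — the local conditions on Selmer classes in Monsky's currency are part 1,
`CongruentNumberEvenMonskySelmerLocal.lean` (its §1–§3 are cited below as "part 1").

The appendix of P. Monsky to Heath-Brown, Invent. Math. 118 (1994) computes the order of the `2`-Selmer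
group of `E_D : y² = x³ − D²x` as `#S⁽²⁾ = 2^{2+s(D)}` with `2^{s(D)} = #ker M` for an explicit `2k × 2k`
matrix `M` over `ℤ/2` built from Legendre symbols of the prime factors of `D`; for EVEN `D = 2p₁⋯p_k` the
matrix is `M = ( Aᵀ + D₂  D₋₁ ; D₂  A + D₂ )` and the printed argument is "a sketch proof" (typescript
p. 40 L40 – p. 41 L44). The tree vendors the statement as the NAMED FACT
`HeathBrown1994.monsky_card_selmerGroup_two_even` (`CongruentTwoSelmerMonskyMatrix.lean`, with the
computable `monskyMatrixEven p` and `monskySelmerRankEven p = 2k − rank M`), consumed as a hypothesis `hMe`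
by the cell `bsd-monsky`'s uniform doors (`P2/CongruentNumberThetaStar*`, `…ThetaThreePrimes*`,
`…EvenAokiMonsky*`, the `k = 2` rung).

THIS FILE PROVES THE UPPER BOUND, UNCONDITIONALLY AND UNIFORMLY IN `k`:

  `card_selmerGroup_two_le_pow_monskySelmerRankEven :
     (∀ i, (p i).Prime) → (∀ i, Odd (p i)) → Function.Injective p →
       Nat.card ((congruentNumberCurve (2 * ∏ i, p i)).selmerGroup 2) ≤ 2 ^ (2 + monskySelmerRankEven p)`

— exactly the `≤` half of the named fact, in its binders. (The `≥` half needs the local solubility of the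
`2^{s}` surviving homogeneous spaces and is not touched.) Every consumer of `hMe` in the cell uses only
`#Sel₂ ≤ 2^{2+s}` (rank bound `r ≤ s`; `Ш[2^∞] = 0` from rank `= s`), so this theorem discharges the
`2`-Selmer display of those doors for every number of prime factors, as
`CongruentNumberEvenFiveSelmerBound*.lean` did for `k = 2` by explicit `4 × 7` matrices.

## The proof (complete `2`-descent on SELMER classes, Silverman AEC X.1.4 / X.1.5 / X.4.9, through the
## tree's descent–Selmer bridge `TwoDescentKummerBridge{,Local,GoodPlace,Rat,AdditivePlace,RealPlace,DyadicCN}`)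

`E_n : y² = (x + n)·x·(x − n)`, `n = 2p₁⋯p_k`, `e₁ = −n < e₂ = 0 < e₃ = n`. A class `c ∈ Sel⁽²⁾(E_n/ℚ)` has
components `[a]` (`T₁ = (−n,0)`, "`x + n`") and `[b]` (`T₂ = (0,0)`, "`x`") in `ℚˣ/ℚˣ²` with (part 1):
`a > 0` (real place); `a`, `b` of even valuation off `{2, p₁, …, p_k}` (good places); at each `pᵢ` (type
`I₀*`, all `v_{pᵢ}(eⱼ − eₗ) = 1`) the two relations
`qr_{pᵢ}(a) = αᵢ([2]ᵢ + A_ii) + βᵢ[2]ᵢ`, `qr_{pᵢ}(b) = αᵢ[−1]ᵢ + βᵢ([−1]ᵢ + [2]ᵢ + A_ii)`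
(`αᵢ = v_{pᵢ}(a)`, `βᵢ = v_{pᵢ}(b) mod 2`, `[m]ᵢ` Monsky's additive symbol of `(m/pᵢ)`,
`A_ij = [pⱼ]ᵢ`, `A_ii = Σ_{j≠i} A_ij`, `qr_{pᵢ}` the residue bit of the `pᵢ`-unit part); at `2` the relation
`v₂(a) ≡ χ₄(b) + χ₄(p₁⋯p_k)·v₂(b)`. The square-free kernel expansions
`qr_{pᵢ}(x) = sign(x)[−1]ᵢ + v₂(x)[2]ᵢ + Σ_{j≠i} A_ij v_{pⱼ}(x)`, `χ₄(x) = sign(x) + Σⱼ [−1]ⱼ v_{pⱼ}(x)` turn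
these into linear relations. NORMALISE by `v₂(b) ≡ 0`, `χ₄(b) = 0` (Monsky's "`a ≡ 1 (mod 4)`", p. 41
L1–L5, for his first coordinate = our `b`; the kernel of this character `ν : Sel⁽²⁾ → (ℤ/2)²` has index
`≤ 4`): then `v₂(a) ≡ 0`, `sign(b) = Σⱼ[−1]ⱼβⱼ`, and the relations say precisely that `(β; α) ∈ ker M` (§2):
the second block row `D₂β + (A + D₂)α = 0` is the relation for `a`; the first, `(Aᵀ + D₂)β + D₋₁α = 0`, is
the relation for `b` after quadratic reciprocity in Monsky's form `A + Aᵀ = D₋₁ + uᵀu`, `u = diag D₋₁`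
(display (31); here `addLegendreSym_swap`). On `ker ν` the coordinates `(β; α)` are injective (§3: all
valuations even, both signs `+`, so both components are squares, and `(H¹(χ₁), H¹(χ₂))` is injective).
Hence `#Sel⁽²⁾ ≤ [Sel⁽²⁾ : ker ν] · #ker M ≤ 4 · 2^{2k − rank M} = 2^{2 + s(n)}` (§4); §1 is the bookkeeping of `M` acting on a vector.

Cell `bsd-monsky` (prover-B): the record of README §3 / paper Remark 5.2 («what the same argument gives for
more prime factors») was relative to {display, TYZ Thm 1.1, GZK, `hMe`}; with this file `hMe` leaves it.
Everything is proved; no named facts; nothing about any class is booked here.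

## References

* [HeathBrown1994SelmerCongruentII] D. R. Heath-Brown, *The size of Selmer groups for the congruent number
  problem, II*, with an appendix by P. Monsky, Invent. Math. 118 (1994) 331–370: §1 (typescript p. 1
  L14–L20, `#S⁽²⁾ = 2^{2+s(D)}`); Appendix pp. 38–42 (the local conditions p. 38 L24–L31; `A`, `D_j`,
  p. 39 L10–L26; `A + Aᵀ = D₋₁ + uᵀu`, p. 39 L37–L41; even `D`, p. 40 L40 – p. 41 L36).
* [SilvermanAEC2009] J. H. Silverman, *The Arithmetic of Elliptic Curves*, 2nd ed., GTM 106, Springer 2009,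
  Prop. X.1.4, Example X.1.5, Thm. X.1.1(c), Prop. X.4.9.
-/

noncomputable section

open scoped Classical

open WeierstrassCurve WeierstrassCurve.Affine WeierstrassCurve.Affine.Point
open Literature.NumberTheory.GaloisRepresentations
open Literature.NumberTheory.EllipticCurves.KramerTwoDescent
open Literature.NumberTheory.EllipticCurves.TwoDescentLocal
open IsDedekindDomain NumberField Rat.HeightOneSpectrum
open Literature.NumberTheory.EllipticCurves.HeathBrown1994
open Matrix

namespace Literature.NumberTheory.EllipticCurves

namespace CongruentNumberEvenMonskySelmer

variable {k : ℕ} {p : Fin k → ℕ}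

/-- `2 ∏ pᵢ ≠ 0`. [folklore] -/
private theorem two_mul_prod_ne_zero (hp : ∀ i, (p i).Prime) : 2 * ∏ i, p i ≠ 0 :=
  mul_ne_zero two_ne_zero (Finset.prod_ne_zero_iff.mpr fun i _ => (hp i).ne_zero)

/-- In `ℤ/2`, `u·u = u`. [folklore] -/
private theorem zmod2_mul_self (u : ZMod 2) : u * u = u := by revert u; decide

/-! ## §1 Monsky's matrices acting on a vector (bookkeeping) -/

/-- `(A x)ᵢ = A_ii xᵢ + Σ_{j ≠ i} [(pⱼ/pᵢ) = −1] xⱼ` with `A_ii = Σ_{l ≠ i} [(p_l/pᵢ) = −1]`.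
[cite: HeathBrown1994SelmerCongruentII, Appendix (Monsky), typescript p. 39 L13–L26] -/
theorem legendreMatrix_mulVec_apply (x : Fin k → ZMod 2) (i : Fin k) :
    (legendreMatrix p *ᵥ x) i =
      (∑ l ∈ Finset.univ.erase i, addLegendreSym (p l) (p i)) * x i +
        ∑ j ∈ Finset.univ.erase i, addLegendreSym (p j) (p i) * x j := by
  simp only [Matrix.mulVec, dotProduct, legendreMatrix, Matrix.of_apply]
  rw [← Finset.add_sum_erase _ _ (Finset.mem_univ i), if_pos rfl]
  congr 1
  exact Finset.sum_congr rfl fun j hj => by rw [if_neg (Finset.ne_of_mem_erase hj).symm]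

/-- `(Aᵀ x)ᵢ = A_ii xᵢ + Σ_{j ≠ i} [(pᵢ/pⱼ) = −1] xⱼ`.
[cite: HeathBrown1994SelmerCongruentII, Appendix (Monsky), typescript p. 41 L31–L36] -/
theorem legendreMatrix_transpose_mulVec_apply (x : Fin k → ZMod 2) (i : Fin k) :
    ((legendreMatrix p)ᵀ *ᵥ x) i =
      (∑ l ∈ Finset.univ.erase i, addLegendreSym (p l) (p i)) * x i +
        ∑ j ∈ Finset.univ.erase i, addLegendreSym (p i) (p j) * x j := by
  simp only [Matrix.mulVec, dotProduct, legendreMatrix, Matrix.transpose_apply, Matrix.of_apply]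
  rw [← Finset.add_sum_erase _ _ (Finset.mem_univ i), if_pos rfl]
  congr 1
  exact Finset.sum_congr rfl fun j hj => by rw [if_neg (Finset.ne_of_mem_erase hj)]

/-- `(D_a x)ᵢ = [(a/pᵢ) = −1] xᵢ`. [cite: HeathBrown1994SelmerCongruentII, Appendix (Monsky), typescript p. 39 L10–L13] -/
theorem legendreDiagonal_mulVec_apply (a : ℤ) (x : Fin k → ZMod 2) (i : Fin k) :
    (legendreDiagonal p a *ᵥ x) i = addLegendreSym a (p i) * x i :=
  Matrix.mulVec_diagonal _ _ _

/-- The two block rows of Monsky's even matrix `M = ( Aᵀ + D₂  D₋₁ ; D₂  A + D₂ )` applied to `(y; x)`.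
[cite: HeathBrown1994SelmerCongruentII, Appendix (Monsky), typescript p. 41 L20–L36] -/
theorem monskyMatrixEven_mulVec_apply (y x : Fin k → ZMod 2) (i : Fin k) :
    (monskyMatrixEven p *ᵥ Sum.elim y x) (Sum.inl i) =
        (∑ l ∈ Finset.univ.erase i, addLegendreSym (p l) (p i)) * y i +
          ∑ j ∈ Finset.univ.erase i, addLegendreSym (p i) (p j) * y j +
          addLegendreSym 2 (p i) * y i + addLegendreSym (-1) (p i) * x i ∧
      (monskyMatrixEven p *ᵥ Sum.elim y x) (Sum.inr i) =
        addLegendreSym 2 (p i) * y i +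
          ((∑ l ∈ Finset.univ.erase i, addLegendreSym (p l) (p i)) * x i +
            ∑ j ∈ Finset.univ.erase i, addLegendreSym (p j) (p i) * x j) +
          addLegendreSym 2 (p i) * x i := by
  rw [monskyMatrixEven, Matrix.fromBlocks_mulVec, Sum.elim_comp_inl, Sum.elim_comp_inr]
  refine ⟨?_, ?_⟩
  · simp only [Sum.elim_inl, Pi.add_apply, Matrix.add_mulVec, legendreMatrix_transpose_mulVec_apply,
      legendreDiagonal_mulVec_apply]
  · simp only [Sum.elim_inr, Pi.add_apply, Matrix.add_mulVec, legendreMatrix_mulVec_apply,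
      legendreDiagonal_mulVec_apply]
    abel

variable [hE : (congruentNumberCurve (2 * ∏ i, p i)).IsElliptic]
variable (hT : (congruentNumberCurve (2 * ∏ i, p i)).toAffine.SplitTwoTorsion
  (-((2 * ∏ i, p i : ℕ) : ℚ)) 0 ((2 * ∏ i, p i : ℕ) : ℚ))

/-! ## §2 Monsky's matrix kills the normalised coordinates of a Selmer class -/

/-- `2 = 0` in `ℤ/2`. [folklore] -/
private theorem two_eq_zero_zmod2 : (2 : ZMod 2) = 0 := by decide

/-- **Monsky's even matrix annihilates the coordinates of a normalised Selmer class.** Let `c ∈ Sel⁽²⁾(E_n/ℚ)`,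
`n = 2p₁⋯p_k`, with components `[a]` (`x + n`) and `[b]` (`x`), normalised by `v₂(b)` even and `χ₄(b) = 0`
(Monsky's "`a ≡ 1 (mod 4)`" for his first coordinate, which is our `b`; then `v₂(a)` is even by the `2`-adic
relation and `a > 0` by the real one — his "`b > 0`, `b ∣ D₀`"). Then the vector
`(v_{pᵢ}(b) mod 2 ; v_{pᵢ}(a) mod 2) ∈ (ℤ/2)^{k} ⊕ (ℤ/2)^{k}` lies in the kernel of
`M = ( Aᵀ + D₂  D₋₁ ; D₂  A + D₂ )`: the first block row is the `I₀*` relation for `b` at each `pᵢ` rewritten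
with quadratic reciprocity `A + Aᵀ = D₋₁ + uᵀu` and `χ₄(b) = 0`, the second block row is the `I₀*` relation
for `a`. [cite: HeathBrown1994SelmerCongruentII, Appendix (Monsky), typescript p. 41 L1–L36]
[cite: SilvermanAEC2009, Prop. X.1.4, Example X.1.5, Prop. X.4.9] -/
theorem monskyMatrixEven_mulVec_eq_zero (hp : ∀ i, (p i).Prime) (hp2 : ∀ i, p i ≠ 2)
    (hinj : Function.Injective p) {c : galH1Torsion (congruentNumberCurve (2 * ∏ i, p i)) 2}
    (hc : c ∈ (congruentNumberCurve (2 * ∏ i, p i)).selmerGroup 2) (a b : ℚˣ)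
    (ha : kummerEquiv ℚ 2 ((congruentNumberCurve (2 * ∏ i, p i)).twoTorsionCharH1 hT c) =
      Additive.ofMul (QuotientGroup.mk a))
    (hb : kummerEquiv ℚ 2 ((congruentNumberCurve (2 * ∏ i, p i)).twoTorsionCharH1 hT.swap₁₂ c) =
      Additive.ofMul (QuotientGroup.mk b))
    (hb2 : parityBit 2 (b : ℚ) = 0) (hb4 : chi4 (b : ℚ) = 0) :
    monskyMatrixEven p *ᵥ Sum.elim (fun i => parityBit (p i) (b : ℚ)) (fun i => parityBit (p i) (a : ℚ)) = 0 := by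
  have ha0 : (a : ℚ) ≠ 0 := a.ne_zero
  have hb0 : (b : ℚ) ≠ 0 := b.ne_zero
  have hev : ∀ r : ℕ, r.Prime → r ≠ 2 → (∀ j, p j ≠ r) →
      Even (padicValRat r (a : ℚ)) ∧ Even (padicValRat r (b : ℚ)) := fun r hr hr2 hrp =>
    even_padicValRat_of_mem hT hp hinj hc a b ha hb hr hr2 hrp
  have hsa : signBit (a : ℚ) = 0 := (signBit_eq_zero_iff ha0).mpr (pos_of_mem hT hp hc a ha)
  have C4 := chi4_expand hp hp2 hinj hb0 fun r hr hr2 hrp => (hev r hr hr2 hrp).2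
  have Dy := dyadic_of_mem hT hp hp2 hc a b ha hb
  rw [hb4] at C4
  rw [hb4, hb2, mul_zero, add_zero] at Dy
  funext s
  rcases s with i | i
  · obtain ⟨E1, -⟩ := monskyMatrixEven_mulVec_apply (p := p) (fun i => parityBit (p i) (b : ℚ))
      (fun i => parityBit (p i) (a : ℚ)) i
    rw [Pi.zero_apply, E1]
    obtain ⟨-, R2⟩ := qrBit_rel_of_mem hT hp hp2 hinj hc a b ha hb i
    have Xb := qrBit_expand hp hp2 hinj i hb0 fun r hr hr2 hrp => (hev r hr hr2 hrp).2
    rw [hb2, mul_zero, add_zero] at Xb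
    have hQR : ∑ j ∈ Finset.univ.erase i, addLegendreSym (p i) (p j) * parityBit (p j) (b : ℚ) =
        ∑ j ∈ Finset.univ.erase i, addLegendreSym (p j) (p i) * parityBit (p j) (b : ℚ) +
          addLegendreSym (-1) (p i) *
            ∑ j ∈ Finset.univ.erase i, addLegendreSym (-1) (p j) * parityBit (p j) (b : ℚ) := by
      rw [Finset.mul_sum, ← Finset.sum_add_distrib]
      exact Finset.sum_congr rfl fun j hj => by
        rw [addLegendreSym_swap (hp j) (hp i) (hp2 j) (hp2 i) (fun h => Finset.ne_of_mem_erase hj (hinj h))]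
        ring
    have hsplit := Finset.add_sum_erase Finset.univ
      (fun j => addLegendreSym (-1) (p j) * parityBit (p j) (b : ℚ)) (Finset.mem_univ i)
    have hDm := zmod2_mul_self (addLegendreSym (-1) (p i))
    rw [hQR]
    set Aii := ∑ l ∈ Finset.univ.erase i, addLegendreSym (p l) (p i) with hAii
    set SAb := ∑ j ∈ Finset.univ.erase i, addLegendreSym (p j) (p i) * parityBit (p j) (b : ℚ) with hSAb
    set SDb := ∑ j ∈ Finset.univ.erase i, addLegendreSym (-1) (p j) * parityBit (p j) (b : ℚ) with hSDb
    set Sf := ∑ j, addLegendreSym (-1) (p j) * parityBit (p j) (b : ℚ) with hSf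
    linear_combination R2 - Xb - addLegendreSym (-1) (p i) * C4 + addLegendreSym (-1) (p i) * hsplit -
      parityBit (p i) (b : ℚ) * hDm +
      (Aii * parityBit (p i) (b : ℚ) + addLegendreSym 2 (p i) * parityBit (p i) (b : ℚ) +
        addLegendreSym (-1) (p i) * parityBit (p i) (a : ℚ) - signBit (b : ℚ) * addLegendreSym (-1) (p i)) *
        two_eq_zero_zmod2
  · obtain ⟨-, E2⟩ := monskyMatrixEven_mulVec_apply (p := p) (fun i => parityBit (p i) (b : ℚ))
      (fun i => parityBit (p i) (a : ℚ)) i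
    rw [Pi.zero_apply, E2]
    obtain ⟨R1, -⟩ := qrBit_rel_of_mem hT hp hp2 hinj hc a b ha hb i
    have Xa := qrBit_expand hp hp2 hinj i ha0 fun r hr hr2 hrp => (hev r hr hr2 hrp).1
    rw [hsa, Dy] at Xa
    simp only [zero_mul, mul_zero, zero_add] at Xa
    set SAa := ∑ j ∈ Finset.univ.erase i, addLegendreSym (p j) (p i) * parityBit (p j) (a : ℚ) with hSAa
    linear_combination Xa - R1 + SAa * two_eq_zero_zmod2

/-! ## §3 The normalised coordinates are injective -/

/-- **Injectivity.** A Selmer class of `E_n` with `v₂(b)`, `χ₄(b)`, all `v_{pᵢ}(b)` and all `v_{pᵢ}(a)` trivial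
(mod `2` / in `ℤ/2`) is `0`: then `a > 0` (real place), `v₂(a)` is even (the `2`-adic relation), `b > 0`
(`χ₄(b) = sign(b) + Σ [(−1/pⱼ)=−1] v_{pⱼ}(b) = sign(b)`), all valuations of `a`, `b` are even, so both
components are squares and `(H¹(χ₁), H¹(χ₂))` is injective. [cite: SilvermanAEC2009, Prop. X.1.4, Thm. X.1.1(c)] -/
theorem eq_zero_of_coords_eq_zero (hp : ∀ i, (p i).Prime) (hp2 : ∀ i, p i ≠ 2) (hinj : Function.Injective p)
    {c : galH1Torsion (congruentNumberCurve (2 * ∏ i, p i)) 2}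
    (hc : c ∈ (congruentNumberCurve (2 * ∏ i, p i)).selmerGroup 2) (a b : ℚˣ)
    (ha : kummerEquiv ℚ 2 ((congruentNumberCurve (2 * ∏ i, p i)).twoTorsionCharH1 hT c) =
      Additive.ofMul (QuotientGroup.mk a))
    (hb : kummerEquiv ℚ 2 ((congruentNumberCurve (2 * ∏ i, p i)).twoTorsionCharH1 hT.swap₁₂ c) =
      Additive.ofMul (QuotientGroup.mk b))
    (hb2 : parityBit 2 (b : ℚ) = 0) (hb4 : chi4 (b : ℚ) = 0) (hβ : ∀ i, parityBit (p i) (b : ℚ) = 0)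
    (hα : ∀ i, parityBit (p i) (a : ℚ) = 0) : c = 0 := by
  have ha0 : (a : ℚ) ≠ 0 := a.ne_zero
  have hb0 : (b : ℚ) ≠ 0 := b.ne_zero
  have hev : ∀ r : ℕ, r.Prime → r ≠ 2 → (∀ j, p j ≠ r) →
      Even (padicValRat r (a : ℚ)) ∧ Even (padicValRat r (b : ℚ)) := fun r hr hr2 hrp =>
    even_padicValRat_of_mem hT hp hinj hc a b ha hb hr hr2 hrp
  have hapos : 0 < (a : ℚ) := pos_of_mem hT hp hc a ha
  have C4 := chi4_expand hp hp2 hinj hb0 fun r hr hr2 hrp => (hev r hr hr2 hrp).2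
  have Dy := dyadic_of_mem hT hp hp2 hc a b ha hb
  rw [hb4, hb2, mul_zero, add_zero] at Dy
  rw [hb4, Finset.sum_eq_zero (fun j _ => by rw [hβ j, mul_zero]), add_zero] at C4
  have hbpos : 0 < (b : ℚ) := (signBit_eq_zero_iff hb0).mp C4.symm
  have hall : ∀ r : ℕ, r.Prime → Even (padicValRat r (a : ℚ)) ∧ Even (padicValRat r (b : ℚ)) := by
    intro r hr
    by_cases hr2 : r = 2
    · subst hr2; exact ⟨parityBit_eq_zero_iff.mp Dy, parityBit_eq_zero_iff.mp hb2⟩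
    by_cases hrp : ∃ j, p j = r
    · obtain ⟨j, rfl⟩ := hrp
      exact ⟨parityBit_eq_zero_iff.mp (hα j), parityBit_eq_zero_iff.mp (hβ j)⟩
    · exact hev r hr hr2 fun j h => hrp ⟨j, h⟩
  have hsa : sqClass (a : ℚ) = 1 := sqClass_eq_one_of_forall ha0 hapos fun r hr => (hall r hr).1
  have hsb : sqClass (b : ℚ) = 1 := sqClass_eq_one_of_forall hb0 hbpos fun r hr => (hall r hr).2
  rw [CongruentNumberTwicePrimePairSelmer.mk_eq_sqClass, hsa, ofMul_one] at ha
  rw [CongruentNumberTwicePrimePairSelmer.mk_eq_sqClass, hsb, ofMul_one] at hb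
  exact (congruentNumberCurve (2 * ∏ i, p i)).eq_zero_of_twoTorsionCharH1_eq_zero hT c
    ((AddEquiv.map_eq_zero_iff _).mp ha) ((AddEquiv.map_eq_zero_iff _).mp hb)


/-! ## §4 The count: `#Sel⁽²⁾(E_n/ℚ) ≤ 4 · #ker M = 2^{2 + s(n)}` -/

omit hE in
/-- **Monsky's `2`-Selmer formula for even `n`, upper-bound half, for every number of prime factors**:
for distinct odd primes `p₁, …, p_k` and `n = 2p₁⋯p_k`,
`#Sel⁽²⁾(E_n/ℚ) ≤ 2^{2 + s(n)}`, `s(n) = 2k − rank_{𝔽₂} M`, `M = ( Aᵀ + D₂  D₋₁ ; D₂  A + D₂ )` Monsky's matrix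
(`HeathBrown1994.monskyMatrixEven`, `monskySelmerRankEven`). Proof: the normalising character
`ν = (v₂(b), χ₄(b)) : Sel⁽²⁾ → (ℤ/2)²` has kernel of index `≤ 4`, and on `ker ν` the coordinates
`(v_{pᵢ}(b); v_{pᵢ}(a))` are an injection into `ker M` (§5, §6); `#ker M = 2^{2k − rank M}`. This is the
`≤` half of the appendix's "`2^{s(D)}` is the size of the kernel of the matrix `M`" (there a sketch proof);
the `≥` half (local solubility of the `2^{s}` systems) is not proved here.
[cite: HeathBrown1994SelmerCongruentII, Appendix (Monsky), typescript p. 41 L1–L36; §1 p. 1 L14–L20]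
[cite: SilvermanAEC2009, Prop. X.1.4, Example X.1.5, Prop. X.4.9] -/
theorem card_selmerGroup_two_le_pow (hp : ∀ i, (p i).Prime) (hp2 : ∀ i, p i ≠ 2)
    (hinj : Function.Injective p) :
    Nat.card ((congruentNumberCurve (2 * ∏ i, p i)).selmerGroup 2) ≤ 2 ^ (2 + monskySelmerRankEven p) := by
  haveI := isElliptic_congruentNumberCurve (two_mul_prod_ne_zero hp)
  haveI : Fact (Nat.Prime 2) := ⟨Nat.prime_two⟩
  haveI : ∀ i, Fact (p i).Prime := fun i => ⟨hp i⟩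
  have hT := splitTwoTorsion_cn (2 * ∏ i, p i)
  set W := congruentNumberCurve (2 * ∏ i, p i) with hW
  -- the two components, the normalising character `ν` and the coordinates `ψ`, as additive maps
  obtain ⟨F₁, hF₁⟩ : ∃ F₁ : galH1Torsion W 2 →+ Additive (SqUnits ℚ),
      ∀ c, F₁ c = kummerEquiv ℚ 2 (W.twoTorsionCharH1 hT c) :=
    ⟨(kummerEquiv ℚ 2).toAddMonoidHom.comp (W.twoTorsionCharH1 hT), fun c => rfl⟩
  obtain ⟨F₂, hF₂⟩ : ∃ F₂ : galH1Torsion W 2 →+ Additive (SqUnits ℚ),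
      ∀ c, F₂ c = kummerEquiv ℚ 2 (W.twoTorsionCharH1 hT.swap₁₂ c) :=
    ⟨(kummerEquiv ℚ 2).toAddMonoidHom.comp (W.twoTorsionCharH1 hT.swap₁₂), fun c => rfl⟩
  obtain ⟨ν, hν⟩ : ∃ ν : galH1Torsion W 2 →+ ZMod 2 × ZMod 2,
      ∀ c, ν c = (parityHom 2 (F₂ c), chi4Hom (F₂ c)) :=
    ⟨((parityHom 2).comp F₂).prod (chi4Hom.comp F₂), fun c => rfl⟩
  obtain ⟨ψ, hψ⟩ : ∃ ψ : galH1Torsion W 2 →+ (Fin k ⊕ Fin k → ZMod 2), ∀ c,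
      ψ c = Sum.elim (fun i => parityHom (p i) (F₂ c)) (fun i => parityHom (p i) (F₁ c)) :=
    ⟨AddMonoidHom.pi fun s => Sum.elim (fun i => (parityHom (p i)).comp F₂)
        (fun i => (parityHom (p i)).comp F₁) s,
      fun c => by funext s; rcases s with i | i <;> rfl⟩
  -- representatives and the values of `ν`, `ψ` on them
  have hrep : ∀ c : galH1Torsion W 2, ∃ a b : ℚˣ,
      kummerEquiv ℚ 2 (W.twoTorsionCharH1 hT c) = Additive.ofMul (QuotientGroup.mk a) ∧
      kummerEquiv ℚ 2 (W.twoTorsionCharH1 hT.swap₁₂ c) = Additive.ofMul (QuotientGroup.mk b) ∧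
      ν c = (parityBit 2 (b : ℚ), chi4 (b : ℚ)) ∧
      ψ c = Sum.elim (fun i => parityBit (p i) (b : ℚ)) (fun i => parityBit (p i) (a : ℚ)) := by
    intro c
    obtain ⟨a, ha⟩ := QuotientGroup.mk_surjective (Additive.toMul (F₁ c))
    obtain ⟨b, hb⟩ := QuotientGroup.mk_surjective (Additive.toMul (F₂ c))
    have ha' : F₁ c = Additive.ofMul (QuotientGroup.mk a) := by rw [ha, ofMul_toMul]
    have hb' : F₂ c = Additive.ofMul (QuotientGroup.mk b) := by rw [hb, ofMul_toMul]
    refine ⟨a, b, (hF₁ c).symm.trans ha', (hF₂ c).symm.trans hb', ?_, ?_⟩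
    · rw [hν c, hb', CongruentNumberTwicePrimePairSelmer.mk_eq_sqClass, parityHom_sqClass b.ne_zero,
        chi4Hom_sqClass b.ne_zero]
    · rw [hψ c, ha', hb', CongruentNumberTwicePrimePairSelmer.mk_eq_sqClass,
        CongruentNumberTwicePrimePairSelmer.mk_eq_sqClass]
      congr 1 <;> funext i <;> exact parityHom_sqClass (Units.ne_zero _)
  -- `ν` restricted to the Selmer group; its kernel `K` has index `≤ 4`
  set νS : W.selmerGroup 2 →+ ZMod 2 × ZMod 2 := ν.comp (W.selmerGroup 2).subtype with hνS
  have hidx : νS.ker.index ≤ 4 := by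
    rw [AddSubgroup.index_ker]
    calc Nat.card νS.range ≤ Nat.card (ZMod 2 × ZMod 2) :=
          Nat.card_le_card_of_injective _ νS.range.subtype_injective
      _ = 4 := by rw [Nat.card_prod, Nat.card_zmod]
  have hmul := νS.ker.card_mul_index
  -- on `K` the coordinates inject into `ker M`
  have hkill : ∀ c : νS.ker, ψ ((c : W.selmerGroup 2) : galH1Torsion W 2) ∈
      LinearMap.ker (monskyMatrixEven p).mulVecLin := by
    intro c
    obtain ⟨a, b, ha, hb, hνc, hψc⟩ := hrep c
    have h0 : ν ((c : W.selmerGroup 2) : galH1Torsion W 2) = 0 := c.2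
    rw [hνc, Prod.mk_eq_zero] at h0
    rw [LinearMap.mem_ker, Matrix.mulVecLin_apply, hψc]
    exact monskyMatrixEven_mulVec_eq_zero hT hp hp2 hinj (c : W.selmerGroup 2).2 a b ha hb h0.1 h0.2
  let f : νS.ker → LinearMap.ker (monskyMatrixEven p).mulVecLin := fun c => ⟨_, hkill c⟩
  have hf : Function.Injective f := by
    intro c₁ c₂ h12
    have h12' : ψ ((c₁ : W.selmerGroup 2) : galH1Torsion W 2) = ψ ((c₂ : W.selmerGroup 2) : galH1Torsion W 2) :=
      congrArg Subtype.val h12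
    set d : galH1Torsion W 2 := ((c₁ : W.selmerGroup 2) : galH1Torsion W 2) - ((c₂ : W.selmerGroup 2) : galH1Torsion W 2)
      with hd
    have hdS : d ∈ W.selmerGroup 2 := sub_mem (c₁ : W.selmerGroup 2).2 (c₂ : W.selmerGroup 2).2
    have hψd : ψ d = 0 := by rw [hd, map_sub, h12', sub_self]
    have hνd : ν d = 0 := by
      have h1 : ν ((c₁ : W.selmerGroup 2) : galH1Torsion W 2) = 0 := c₁.2
      have h2 : ν ((c₂ : W.selmerGroup 2) : galH1Torsion W 2) = 0 := c₂.2
      rw [hd, map_sub, h1, h2, sub_zero]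
    obtain ⟨a, b, ha, hb, hνc, hψc⟩ := hrep d
    rw [hνc, Prod.mk_eq_zero] at hνd
    rw [hψc] at hψd
    have hβ : ∀ i, parityBit (p i) (b : ℚ) = 0 := fun i => congr_fun hψd (Sum.inl i)
    have hα : ∀ i, parityBit (p i) (a : ℚ) = 0 := fun i => congr_fun hψd (Sum.inr i)
    have hd0 : d = 0 := eq_zero_of_coords_eq_zero hT hp hp2 hinj hdS a b ha hb hνd.1 hνd.2 hβ hα
    exact Subtype.ext (Subtype.ext (sub_eq_zero.mp hd0))
  have hker : Nat.card νS.ker ≤ 2 ^ (2 * k - (monskyMatrixEven p).rank) := by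
    have := Nat.card_le_card_of_injective f hf
    rwa [natCard_ker_mulVecLin_eq, Fintype.card_sum, Fintype.card_fin, ← two_mul] at this
  calc Nat.card (W.selmerGroup 2) = Nat.card νS.ker * νS.ker.index := hmul.symm
    _ ≤ 2 ^ (2 * k - (monskyMatrixEven p).rank) * 4 := Nat.mul_le_mul hker hidx
    _ = 2 ^ (2 + monskySelmerRankEven p) := by rw [monskySelmerRankEven, pow_add]; ring

end CongruentNumberEvenMonskySelmer

/-- **Monsky's `2`-Selmer formula, even case, UPPER-BOUND HALF — for every `k`** (instance-free form, in the
binders of the named fact `HeathBrown1994.monsky_card_selmerGroup_two_even`): for `p₁, …, p_k` distinct odd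
primes, `#Sel⁽²⁾(E_{2p₁⋯p_k}/ℚ) ≤ 2^{2 + s}`, `s = 2k − rank_{𝔽₂} M`, `M = ( Aᵀ + D₂  D₋₁ ; D₂  A + D₂ )`.
By complete `2`-descent on Selmer classes (Silverman AEC X.1.4 / X.1.5 / X.4.9 through the tree's
descent–Selmer bridge); the printed even case is "a sketch proof". Unconditional; the `≥` half is NOT claimed.
[cite: HeathBrown1994SelmerCongruentII, Appendix (Monsky), typescript p. 41 L1–L36; §1 p. 1 L14–L20]
[cite: SilvermanAEC2009, Prop. X.1.4, Example X.1.5, Prop. X.4.9] -/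
theorem card_selmerGroup_two_le_pow_monskySelmerRankEven (k : ℕ) (p : Fin k → ℕ)
    (hp : ∀ i, (p i).Prime) (hodd : ∀ i, Odd (p i)) (hinj : Function.Injective p) :
    Nat.card ((congruentNumberCurve (2 * ∏ i, p i)).selmerGroup 2) ≤ 2 ^ (2 + monskySelmerRankEven p) :=
  CongruentNumberEvenMonskySelmer.card_selmerGroup_two_le_pow hp
    (fun i h => Nat.not_even_iff_odd.mpr (hodd i) (h ▸ even_two)) hinj

end Literature.NumberTheory.EllipticCurves

end
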